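import Summits.BirchSwinnertonDyer.BirchSwinnertonDyer.Theorems.UniversalToricDescentTameQuotientVanishing
import HarnessLib

/-!
# Route UniversalToricDescent — `H¹(G, A) ↪ (A^N)_{τ}` for a profinite `G = cl⟨N, τ⟩` with `N` pro-prime-to-`p`:
# representatives vanishing on `N` and the injectivity of `[φ] ↦ φ(τ) mod (τ − 1)A^N`

Lead prover bsd-wall-utd-p1 g10 (`--supports stmt-BirchSwinnertonDyer-20399`; part 1 of the general form of
the Greenberg–Vatsal Prop. (2.4) inertia computation `H¹(I_ℓ, A) = H¹(I_ℓ/J_ℓ, A^{J_ℓ}) = (A^{J_ℓ})_{τ}`, of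
which `UniversalToricDescentTameQuotientVanishing` is the case "`τ − 1` onto"; part 2 =
`UniversalToricDescentTameQuotientSurjective`). Setting: `G` profinite, `N ⊴ G` closed and
pro-prime-to-`p`, `τ ∈ G` with `G = ⋃ₖ τᵏ N U` at every open normal level `U`; `A` a discrete `p`-primary
`G`-module; `C = A^N`.

* `exists_oneCocycleClass_eq_vanishing` — every class of `H¹(G, A)` has a representative vanishing on `N`
  (`H¹(N, A) = 0`); such a cocycle takes values in `C` (`apply_mem_invariants_of_vanishing`).
* `oneCocycleClass_eq_iff_of_vanishing` — two cocycles vanishing on `N` are cohomologous iff their values at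
  `τ` differ by an element of `(τ − 1)C`: `[φ] ↦ φ(τ) mod (τ − 1)C` embeds `H¹(G, A) ↪ C/(τ − 1)C`.
* `exists_invariant_nsmul_eq` — `C` is `p`-divisible when `A` is (`H¹(N, A[p]) = 0`).

THEOREMS ONLY; no definition, no named fact, no `sorry`. BSD is not advanced by this file.
References: [GreenbergVatsal2000] §2, proof of Prop. (2.4) (arXiv p. 22); [SerreLocalFields1979] Ch. XIII
§1 Prop. 1; [SerreGaloisCohomology1997] I §3.3 Prop. 14 Cor. 2.
-/

set_option autoImplicit false
-- `…BirchSwinnertonDyer.BirchSwinnertonDyer.Theorems…` is the problem's mandated namespace (D-0017).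
set_option linter.dupNamespace false

noncomputable section

open scoped Classical

namespace Summit.BirchSwinnertonDyer.BirchSwinnertonDyer.Theorems.UniversalToricDescentTameQuotientEvaluation

open Literature.NumberTheory.GaloisRepresentations ContinuousCohomology Topology Function
  Summit.BirchSwinnertonDyer.BirchSwinnertonDyer.Theorems.UniversalToricDescentProPrimeToP
  Summit.BirchSwinnertonDyer.BirchSwinnertonDyer.Theorems.UniversalToricDescentTameQuotientVanishing

variable {G : Type} [Group G] [TopologicalSpace G] [IsTopologicalGroup G] [CompactSpace G]
  [TotallyDisconnectedSpace G]
variable {M : Type} [AddCommGroup M] [TopologicalSpace M] [DiscreteTopology M]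
variable (ρ : ContinuousRep G ℤ M) {p : ℕ}

/-! ### §1 Coboundaries; an open subgroup containing `N` and `τ` is everything -/

omit [CompactSpace G] [TotallyDisconnectedSpace G] in
/-- The coboundary `g ↦ g a − a` as a continuous crossed homomorphism, of trivial class. [folklore] -/
theorem exists_coboundary (a : M) :
    ∃ ψ : contOneCocycles ρ.toTopRep, (∀ g : G, ψ.1 g = ρ g a - a) ∧ oneCocycleClass _ ψ = 0 := by
  let ψ : contOneCocycles ρ.toTopRep :=
    ⟨⟨fun g ↦ ρ g a - a, (ρ.continuous_apply_left a).sub continuous_const⟩, fun g h ↦ by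
      show ρ (g * h) a - a = (ρ g a - a) + ρ g (ρ h a - a)
      rw [map_mul, Module.End.mul_apply, map_sub]
      abel⟩
  exact ⟨ψ, fun _ ↦ rfl, (oneCocycleClass_eq_zero_iff _ ψ).mpr ⟨a, fun _ ↦ rfl⟩⟩

omit [DiscreteTopology M] in
/-- An open subgroup containing `N` and `τ` is everything, when `G = ⋃ₖ τᵏ N U` at every open normal
level `U`. [folklore] -/
theorem forall_mem_of_isOpen (N : Subgroup G) (τ : G)
    (hgen : ∀ U : Subgroup G, U.Normal → IsOpen (U : Set G) →
      ∀ σ : G, ∃ k : ℕ, ∃ n ∈ N, ∃ u ∈ U, σ = τ ^ k * n * u)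
    (Z : Subgroup G) (hZ : IsOpen (Z : Set G)) (hNZ : N ≤ Z) (hτZ : τ ∈ Z) (σ : G) : σ ∈ Z := by
  obtain ⟨U, hU⟩ := ProfiniteGrp.exist_openNormalSubgroup_sub_open_nhds_of_one hZ Z.one_mem
  obtain ⟨k, n, hn, u, hu, rfl⟩ := hgen U inferInstance U.isOpen' σ
  exact Z.mul_mem (Z.mul_mem (Z.pow_mem hτZ k) (hNZ hn)) (hU hu)

/-! ### §2 Representatives vanishing on `N` -/

/-- **Every class of `H¹(G, A)` has a representative vanishing on the pro-prime-to-`p` closed normal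
subgroup `N`** (`H¹(N, A) = 0` for the `p`-primary `A`). [cite: SerreGaloisCohomology1997, I §3.3 Prop. 14 Cor. 2] -/
theorem exists_oneCocycleClass_eq_vanishing (hM : ∀ m : M, ∃ k : ℕ, p ^ k • m = 0)
    (N : Subgroup G) (hNc : IsClosed (N : Set G))
    (hcopN : ∀ U : Subgroup N, U.Normal → IsOpen (U : Set N) → U.index.Coprime p)
    (φ : contOneCocycles ρ.toTopRep) :
    ∃ φ' : contOneCocycles ρ.toTopRep,
      oneCocycleClass _ φ' = oneCocycleClass _ φ ∧ ∀ n ∈ N, φ'.1 n = 0 := by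
  haveI : CompactSpace N := isCompact_iff_compactSpace.mp hNc.isCompact
  let ρN : ContinuousRep N ℤ M := ρ.restrict (subgroupIncl N)
  haveI : Subsingleton (continuousCohomology 1 ρN.toTopRep) :=
    subsingleton_continuousCohomology_one_of_coprime_index ρN hcopN hM
  let φN : contOneCocycles ρN.toTopRep :=
    ⟨φ.1.comp ⟨((↑) : N → G), continuous_subtype_val⟩, fun n n' ↦ by
      show φ.1 ((n : G) * n') = φ.1 n + ρ (n : G) (φ.1 n')
      exact φ.2 n n'⟩
  obtain ⟨a, ha⟩ := (oneCocycleClass_eq_zero_iff _ φN).mp (Subsingleton.elim _ _)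
  obtain ⟨ψ, hψ, hψ0⟩ := exists_coboundary ρ a
  refine ⟨φ - ψ, by rw [oneCocycleClass_sub, hψ0, sub_zero], fun n hn ↦ ?_⟩
  show φ.1 n - ψ.1 n = 0
  rw [hψ, sub_eq_zero]
  exact ha ⟨n, hn⟩

omit [IsTopologicalGroup G] [CompactSpace G] [TotallyDisconnectedSpace G] in
/-- A crossed homomorphism vanishing on the normal subgroup `N` takes values in the invariants `A^N`.
[folklore] -/
theorem apply_mem_invariants_of_vanishing (N : Subgroup G) [N.Normal] (φ : contOneCocycles ρ.toTopRep)
    (hφ : ∀ n ∈ N, φ.1 n = 0) (g : G) : ∀ n ∈ N, ρ n (φ.1 g) = φ.1 g := by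
  intro n hn
  have hf : ∀ g h : G, φ.1 (g * h) = φ.1 g + ρ g (φ.1 h) := fun g h ↦ φ.2 g h
  have h1 : φ.1 (n * g) = ρ n (φ.1 g) := by rw [hf, hφ n hn, zero_add]
  have hconj : g⁻¹ * n * g ∈ N := by
    have := ‹N.Normal›.conj_mem n hn g⁻¹
    rwa [inv_inv] at this
  have h2 : φ.1 (n * g) = φ.1 g := by
    rw [show n * g = g * (g⁻¹ * n * g) by group, hf, hφ _ hconj, map_zero, add_zero]
  rw [← h1, h2]

/-! ### §3 Injectivity of `[φ] ↦ φ(τ) mod (τ − 1)A^N` -/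

/-- **Two cocycles vanishing on `N` are cohomologous iff their values at `τ` differ by `τc − c` for an
`N`-invariant `c`.** [cite: SerreLocalFields1979, Ch. XIII §1 Prop. 1] -/
theorem oneCocycleClass_eq_iff_of_vanishing (N : Subgroup G) [N.Normal] (τ : G)
    (hgen : ∀ U : Subgroup G, U.Normal → IsOpen (U : Set G) →
      ∀ σ : G, ∃ k : ℕ, ∃ n ∈ N, ∃ u ∈ U, σ = τ ^ k * n * u)
    (φ ψ : contOneCocycles ρ.toTopRep) (hφ : ∀ n ∈ N, φ.1 n = 0) (hψ : ∀ n ∈ N, ψ.1 n = 0) :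
    oneCocycleClass _ φ = oneCocycleClass _ ψ ↔
      ∃ c : M, (∀ n ∈ N, ρ n c = c) ∧ φ.1 τ - ψ.1 τ = ρ τ c - c := by
  constructor
  · intro h
    rw [← sub_eq_zero, ← oneCocycleClass_sub, oneCocycleClass_eq_zero_iff] at h
    obtain ⟨v, hv⟩ := h
    refine ⟨v, fun n hn ↦ ?_, hv τ⟩
    have := hv n
    rw [show (φ - ψ).1 n = φ.1 n - ψ.1 n from rfl, hφ n hn, hψ n hn, sub_self] at this
    exact (sub_eq_zero.mp this.symm)
  · rintro ⟨c, hcN, hc⟩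
    rw [← sub_eq_zero, ← oneCocycleClass_sub, oneCocycleClass_eq_zero_iff]
    refine ⟨c, fun g ↦ ?_⟩
    -- `χ = φ − ψ − ∂c` vanishes on `N` and at `τ`, hence everywhere
    let χ : G → M := fun g ↦ (φ - ψ).1 g - (ρ g c - c)
    have hχdef : ∀ g, χ g = φ.1 g - ψ.1 g - (ρ g c - c) := fun _ ↦ rfl
    have hf : ∀ g h : G, (φ - ψ).1 (g * h) = (φ - ψ).1 g + ρ g ((φ - ψ).1 h) :=
      fun g h ↦ (φ - ψ).2 g h
    have hχ : ∀ g h : G, χ (g * h) = χ g + ρ g (χ h) := fun g h ↦ by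
      simp only [χ, hf, map_sub, map_mul, Module.End.mul_apply]
      abel
    have hχ1 : χ 1 = 0 := by
      rw [hχdef, contOneCocycles.apply_one, contOneCocycles.apply_one, map_one, Module.End.one_apply]
      abel
    have hχN : ∀ n ∈ N, χ n = 0 := fun n hn ↦ by
      rw [hχdef, hφ n hn, hψ n hn, hcN n hn]
      abel
    have hχτ : χ τ = 0 := by rw [hχdef, hc, sub_self]
    have hχcont : Continuous χ :=
      (φ - ψ).1.continuous.sub ((ρ.continuous_apply_left c).sub continuous_const)
    let Z : Subgroup G :=
      { carrier := {g | χ g = 0}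
        one_mem' := hχ1
        mul_mem' := fun {g h} hg hh ↦ by
          simp only [Set.mem_setOf_eq] at hg hh ⊢
          rw [hχ, hg, hh, map_zero, add_zero]
        inv_mem' := fun {g} hg ↦ by
          simp only [Set.mem_setOf_eq] at hg ⊢
          have h := hχ g⁻¹ g
          rw [inv_mul_cancel, hχ1, hg, map_zero, add_zero] at h
          exact h.symm }
    have hZ : IsOpen (Z : Set G) := (isOpen_discrete ({(0 : M)} : Set M)).preimage hχcont
    have hzero : χ g = 0 := forall_mem_of_isOpen N τ hgen Z hZ (fun n hn ↦ hχN n hn) hχτ g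
    exact sub_eq_zero.mp hzero

/-! ### §4 The `N`-invariants of a divisible module are divisible -/

/-- The `N`-invariants of a `p`-divisible `A` are `p`-divisible (`H¹(N, A[p]) = 0`). [folklore] -/
theorem exists_invariant_nsmul_eq (hdiv : ∀ m : M, ∃ m' : M, p • m' = m)
    (N : Subgroup G) (hNc : IsClosed (N : Set G))
    (hcopN : ∀ U : Subgroup N, U.Normal → IsOpen (U : Set N) → U.index.Coprime p)
    (c : M) (hc : ∀ n ∈ N, ρ n c = c) : ∃ c' : M, (∀ n ∈ N, ρ n c' = c') ∧ p • c' = c := by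
  haveI : CompactSpace N := isCompact_iff_compactSpace.mp hNc.isCompact
  let ρN : ContinuousRep N ℤ M := ρ.restrict (subgroupIncl N)
  have hMp : ∀ m : Submodule.torsionBy ℤ M (p : ℤ), ∃ k : ℕ, p ^ k • m = 0 := fun m ↦
    ⟨1, Subtype.ext (by
      rw [pow_one, AddSubmonoidClass.coe_nsmul, ZeroMemClass.coe_zero]
      exact (ContinuousRep.mem_torsionBy_nsmul_iff p).mp m.2)⟩
  haveI : Subsingleton (continuousCohomology 1 (ρN.torsionRep p).toTopRep) :=
    subsingleton_continuousCohomology_one_of_coprime_index (ρN.torsionRep p) hcopN hMp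
  obtain ⟨b, hb⟩ := hdiv c
  have hval : ∀ n : N, ρ (n : G) b - b ∈ Submodule.torsionBy ℤ M (p : ℤ) := fun n ↦ by
    rw [ContinuousRep.mem_torsionBy_nsmul_iff, smul_sub, ← map_nsmul, hb, hc _ n.2, sub_self]
  let ψ : contOneCocycles (ρN.torsionRep p).toTopRep :=
    ⟨⟨fun n ↦ ⟨ρ (n : G) b - b, hval n⟩,
      (((ρ.continuous_apply_left b).comp continuous_subtype_val).sub continuous_const).subtype_mk _⟩,
      fun n n' ↦ Subtype.ext (by
        show ρ ((n * n' : N) : G) b - b = (ρ (n : G) b - b) + ρ (n : G) (ρ (n' : G) b - b)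
        rw [Subgroup.coe_mul, map_mul, Module.End.mul_apply, map_sub]
        abel)⟩
  obtain ⟨v, hv⟩ := (oneCocycleClass_eq_zero_iff _ ψ).mp (Subsingleton.elim _ _)
  have hv' : ∀ n : N, ρ (n : G) b - b = ρ (n : G) (v : M) - v := fun n ↦ congrArg Subtype.val (hv n)
  refine ⟨b - v, fun n hn ↦ ?_, ?_⟩
  · rw [map_sub]
    exact sub_eq_sub_iff_sub_eq_sub.mp (hv' ⟨n, hn⟩)
  · rw [smul_sub, hb, (ContinuousRep.mem_torsionBy_nsmul_iff p).mp v.2, sub_zero]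

end Summit.BirchSwinnertonDyer.BirchSwinnertonDyer.Theorems.UniversalToricDescentTameQuotientEvaluation

end
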